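import Summits.Ventures.YMGap.FlowData.RectTubeMomentumPiStates
import Summits.Ventures.YMGap.FlowData.RectTubeTorelonEnvelope
import HarnessLib

/-!
# Venture YMGap, track Y3 FLOW-DATA — the UPPER strong-coupling window edge of the transverse-momentum-π torelon energy on
# rectangular tubes: `E_{ê_μ}^{π_ν}(β) ≤ (Ls μ)·(−ln u(β)) + 2β · #plaquettes` (`ν ≠ μ`, `Ls ν` even; theorems only)

HONEST FRAMING: venture file of the cell `pub-ymgap` (QuantumFields programme), track Y3; companion THEOREMS for
`FlowData/RectTubeTranslations.lean` (`su2RectFluxMomentumPiEnergy` = the FLOW-TABLE's `E_y^π` of the `2×1×1` tube): the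
quantitative alternating multi-line witness of `FlowData/RectTubeMomentumPiStates.lean` and the envelope
`‖T‖ ≤ e^{β#P} c₀^N` of `FlowData/RectTubeTorelonEnvelope.lean`.  Finite rectangular torus; no number of the FLOW-TABLE, no
row, nothing about `L → ∞`, the continuum or a mass gap.  The two-sided window (lower edge = the torelon's own window via
`Δ_p ≥ 0`) is `FlowData/RectTubeMomentumPiWindow.lean` (needs `RectTubeStrongCouplingWindow`).

* `rectTubeFluxMomentumPiNorm_single_ge` — `e^{−|J| n P} c₀^{N−Ls μ} λ^{Ls μ} ≤ ‖T ∘ P_{ê_μ} ∘ Π_ν‖` (general compact group,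
  unitary continuous `ρ` with `ρ(z) = −1`, `z` central, `n ≠ 0`, `ν ≠ μ`, `Ls ν` even);
* **`su2RectFluxMomentumPiEnergy_le_window`** — for `SU(2)`, `β > 0`, `ν ≠ μ`, `Ls ν` even:
  `su2RectFluxMomentumPiEnergy β Ls ê_μ ν ≤ (Ls μ)·(−ln u(β)) + 2β · (#sites · k(k−1)/2)`.

References: G. 't Hooft, Nucl. Phys. B 153 (1979) 141 [cite: tHooft1979Flux]; M. Lüscher, Commun. Math. Phys. 54 (1977)
283 [cite: Luscher1977]; I. Montvay, G. Münster (1994) §3.2.6 [cite: MontvayMunster1994, §3.2.6].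
-/

noncomputable section

open scoped BigOperators Topology
open MeasureTheory Filter Function
open Literature.MathematicalPhysics.QuantumFieldTheory Literature.Analysis.OperatorTheory
open Literature.Barriers.QuantumFields
open Summit.Ventures.LatticeQCDFlow.Exactness Summit.Ventures.LatticeQCDFlow.Scoring
open Summit.Ventures.YMGap.Conjectures (su2CharacterRatio su2CharacterRatio_pos)
open Literature.MathematicalPhysics.QuantumLattice (RectTorusSite fundamentalRep continuous_fundamentalRep
  fundamentalRep_mem_unitaryGroup)

namespace Summit.Ventures.YMGap.FlowData

/-! ### The quantitative alternating witness (general compact group) -/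

section Quantitative

variable {G : Type*} [Group G] [TopologicalSpace G] [IsTopologicalGroup G] [CompactSpace G]
  [MeasurableSpace G] [BorelSpace G] [SecondCountableTopology G] {n : ℕ} (ρ : G →* Matrix (Fin n) (Fin n) ℂ)
  (J : ℝ) {k : ℕ} {Ls : Fin k → ℕ} [∀ i, NeZero (Ls i)]

/-- **`e^{−|J| n P} c₀^{N−Ls μ} λ^{Ls μ} ≤ ‖T ∘ P_{ê_μ} ∘ Π_ν‖`** for `ν ≠ μ`, `Ls ν` even (unitary continuous `ρ` with
`ρ(z) = −1`, `z` central, `n ≠ 0`; `c₀ = ∫ e^{J Re tr ρ}`, `λ` the Schur scalar, `N` links, `P = #sites · k(k−1)/2`): the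
alternating multi-line state has `⟪ψ, Tψ⟫ = c₀^{N−Ls μ} λ^{Ls μ} ∫ W̃²` and `‖ψ‖² ≤ e^{|J| n P} ∫ W̃²`.
[cite: tHooft1979Flux] [cite: MontvayMunster1994, §3.2.6] -/
theorem rectTubeFluxMomentumPiNorm_single_ge (hρ : Continuous ρ) (hρu : ∀ g, ρ g ∈ Matrix.unitaryGroup (Fin n) ℂ)
    (hn : n ≠ 0) {z : G} (hz : z ∈ Subgroup.center G) (hρz : ρ z = -1) {lam : ℝ}
    (hM : ∀ i j, ∫ c, (Real.exp (J * (ρ c).trace.re) : ℂ) * ρ c i j ∂haarProbability G = if i = j then (lam : ℂ) else 0)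
    {μ ν : Fin k} (hμν : μ ≠ ν) (hν : Even (Ls ν)) :
    Real.exp (-(|J| * (n * (Fintype.card (RectTorusSite Ls) * Fintype.card {p : Fin k × Fin k // p.1 < p.2})))) *
        ((∫ g, Real.exp (J * (ρ g).trace.re) ∂haarProbability G) ^ (Fintype.card (RectTorusSite Ls × Fin k) - Ls μ) *
          lam ^ (Ls μ)) ≤
      rectTubeFluxMomentumPiNorm ρ z J Ls (Pi.single μ 1) ν := by
  obtain ⟨W, hWc, hmem, hP, hPi, hinner, hW2pos⟩ := exists_rectMomentumPiWitness ρ J hρ hn hz hρz hM hμν hν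
  set P : ℝ := n * (Fintype.card (RectTorusSite Ls) * Fintype.card {p : Fin k × Fin k // p.1 < p.2}) with hP'
  set ψ : Lp ℝ 2 (rectSliceMeasure G Ls) := hmem.toLp _ with hψ
  set A : Lp ℝ 2 (rectSliceMeasure G Ls) →L[ℝ] Lp ℝ 2 (rectSliceMeasure G Ls) :=
    (rectTubeTransferOperator ρ J Ls).comp ((rectTubeFluxProjection z Ls (Pi.single μ 1)).comp (rectMomentumPiOp Ls ν))
    with hA
  have hAψ : A ψ = rectTubeTransferOperator ρ J Ls ψ := by
    simp only [hA, ContinuousLinearMap.comp_apply, hPi, hP]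
  -- `‖ψ‖² ≤ e^{|J| n P} ∫ W²`
  have hW2i : Integrable (fun b => W b ^ 2) (rectSliceMeasure G Ls) :=
    (hWc.pow 2).integrable_of_hasCompactSupport (HasCompactSupport.of_compactSpace _)
  have hnorm : ‖ψ‖ ^ 2 ≤ Real.exp (|J| * P) * ∫ b, W b ^ 2 ∂(rectSliceMeasure G Ls) := by
    rw [norm_sq_eq_integral_sq, ← integral_const_mul]
    have hae := hmem.coeFn_toLp
    refine integral_mono_ae ((Lp.memLp ψ).integrable_sq) (hW2i.const_mul _) ?_
    filter_upwards [hae] with b hb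
    rw [hb, mul_pow, ← Real.exp_nat_mul]
    have h2 : ((2 : ℕ) : ℝ) * -(J / 2 * rectMagSum (Ls := Ls) ρ b) = -(J * rectMagSum (Ls := Ls) ρ b) := by
      push_cast; ring
    rw [h2]
    exact mul_le_mul_of_nonneg_right (exp_neg_rectMagSum_le ρ J hρu b) (sq_nonneg _)
  -- `⟪ψ, Tψ⟫ = ⟪ψ, A ψ⟫ ≤ ‖A‖ ‖ψ‖²`
  have hle : (∫ g, Real.exp (J * (ρ g).trace.re) ∂haarProbability G) ^ (Fintype.card (RectTorusSite Ls × Fin k) - Ls μ) *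
      lam ^ (Ls μ) * ∫ b, W b ^ 2 ∂(rectSliceMeasure G Ls) ≤ ‖A‖ * ‖ψ‖ ^ 2 := by
    rw [← hinner, ← hAψ]
    calc @inner ℝ _ _ ψ (A ψ) ≤ ‖ψ‖ * ‖A ψ‖ := real_inner_le_norm _ _
      _ ≤ ‖ψ‖ * (‖A‖ * ‖ψ‖) := mul_le_mul_of_nonneg_left (A.le_opNorm ψ) (norm_nonneg _)
      _ = ‖A‖ * ‖ψ‖ ^ 2 := by ring
  have hA0 : 0 ≤ ‖A‖ := norm_nonneg _
  have h3 : (∫ g, Real.exp (J * (ρ g).trace.re) ∂haarProbability G) ^ (Fintype.card (RectTorusSite Ls × Fin k) - Ls μ) *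
      lam ^ (Ls μ) * ∫ b, W b ^ 2 ∂(rectSliceMeasure G Ls) ≤
      ‖A‖ * (Real.exp (|J| * P) * ∫ b, W b ^ 2 ∂(rectSliceMeasure G Ls)) :=
    hle.trans (mul_le_mul_of_nonneg_left hnorm hA0)
  have hexp : 0 < Real.exp (|J| * P) := Real.exp_pos _
  have h4 : (∫ g, Real.exp (J * (ρ g).trace.re) ∂haarProbability G) ^ (Fintype.card (RectTorusSite Ls × Fin k) - Ls μ) *
      lam ^ (Ls μ) ≤ ‖A‖ * Real.exp (|J| * P) :=
    le_of_mul_le_mul_right (by nlinarith [h3]) hW2pos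
  unfold rectTubeFluxMomentumPiNorm
  rw [← hA, Real.exp_neg]
  calc (Real.exp (|J| * P))⁻¹ *
        ((∫ g, Real.exp (J * (ρ g).trace.re) ∂haarProbability G) ^ (Fintype.card (RectTorusSite Ls × Fin k) - Ls μ) *
          lam ^ (Ls μ))
      ≤ (Real.exp (|J| * P))⁻¹ * (‖A‖ * Real.exp (|J| * P)) := mul_le_mul_of_nonneg_left h4 (inv_nonneg.2 hexp.le)
    _ = ‖A‖ := by field_simp

end Quantitative

/-! ### The cell's object: `SU(2)`, the window of `E_{ê_μ}^{π_ν}` -/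

section SU2

open Literature.MathematicalPhysics.QuantumLattice (fundamentalRep continuous_fundamentalRep fundamentalRep_mem_unitaryGroup)

variable {k : ℕ}

/-- **THE UPPER WINDOW EDGE OF THE MOMENTUM-π TORELON ENERGY.**  On every rectangular tube `Π_i ℤ/(Ls i)`, axis `μ`,
transverse axis `ν ≠ μ` with `Ls ν` even, and every `β > 0`:
`su2RectFluxMomentumPiEnergy β Ls ê_μ ν ≤ (Ls μ)·(−ln u(β)) + 2β · (#sites · k(k−1)/2)` (the quantitative alternating witness
and `‖T‖ ≤ e^{β#P} c₀^N`). [cite: MontvayMunster1994, §3.2.6] [cite: tHooft1979Flux] -/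
theorem su2RectFluxMomentumPiEnergy_le_window {β : ℝ} (hβ : 0 < β) (Ls : Fin k → ℕ) [∀ i, NeZero (Ls i)]
    {μ ν : Fin k} (hμν : μ ≠ ν) (hν : Even (Ls ν)) :
    su2RectFluxMomentumPiEnergy β Ls (Pi.single μ 1) ν ≤
      ((Ls μ : ℕ) : ℝ) * (-Real.log (su2CharacterRatio β)) +
        2 * β * (Fintype.card (RectTorusSite Ls) * Fintype.card {p : Fin k × Fin k // p.1 < p.2}) := by
  haveI : SecondCountableTopology (Matrix.specialUnitaryGroup (Fin 2) ℂ) :=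
    Literature.MathematicalPhysics.QuantumLattice.secondCountableTopology_su2
  set P : ℝ := (Fintype.card (RectTorusSite Ls) : ℝ) * (Fintype.card {p : Fin k × Fin k // p.1 < p.2} : ℝ) with hP
  set N : ℕ := Fintype.card (RectTorusSite Ls × Fin k) with hN
  set c0 : ℝ := ∫ U : Matrix.specialUnitaryGroup (Fin 2) ℂ, Real.exp (β * su2a0 U)
    ∂haarProbability (Matrix.specialUnitaryGroup (Fin 2) ℂ) with hc0
  set lam : ℝ := ∫ U : Matrix.specialUnitaryGroup (Fin 2) ℂ, Real.exp (β * su2a0 U) * su2a0 U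
    ∂haarProbability (Matrix.specialUnitaryGroup (Fin 2) ℂ) with hlam
  have hc0' : (∫ g : Matrix.specialUnitaryGroup (Fin 2) ℂ, Real.exp (β / 2 * ((fundamentalRep (Fin 2) g).trace).re)
      ∂haarProbability (Matrix.specialUnitaryGroup (Fin 2) ℂ)) = c0 :=
    integral_congr_ae (Eventually.of_forall fun U => by simp only [su2_weight_eq]; ring_nf)
  have hlam' : (∫ U : Matrix.specialUnitaryGroup (Fin 2) ℂ, Real.exp (2 * (β / 2) * su2a0 U) * su2a0 U
      ∂haarProbability (Matrix.specialUnitaryGroup (Fin 2) ℂ)) = lam := by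
    rw [show 2 * (β / 2) = β by ring]
  have hu : lam / c0 = su2CharacterRatio β := by
    have h := su2_schurScalar_div_weightMass (β / 2)
    rw [show 2 * (β / 2) = β by ring] at h
    exact h
  have hc0pos : 0 < c0 := by
    have h := su2_weightMass_pos (β / 2)
    rwa [show 2 * (β / 2) = β by ring] at h
  have hupos : 0 < su2CharacterRatio β := su2CharacterRatio_pos hβ
  have hlampos : 0 < lam := by
    have h := div_mul_cancel₀ lam hc0pos.ne'
    rw [hu] at h
    rw [← h]
    exact mul_pos hupos hc0pos
  have hLN : Ls μ ≤ N := by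
    have h := Fintype.card_le_of_injective _ (rectLine_injective (Ls := Ls) μ)
    rwa [Fintype.card_fin] at h
  have hJ : |β / 2| * ((2 : ℕ) * ((Fintype.card (RectTorusSite Ls) : ℝ) *
      (Fintype.card {p : Fin k × Fin k // p.1 < p.2} : ℝ))) = β * P := by
    rw [abs_of_pos (half_pos hβ)]; push_cast; ring
  -- upper half: `‖T‖ ≤ e^{βP} c0^N`, `‖T P Π‖ ≥ e^{−βP} c0^{N−L} λ^L`
  have hTle : ‖rectTubeTransferOperator (fundamentalRep (Fin 2)) (β / 2) Ls‖ ≤ Real.exp (β * P) * c0 ^ N := by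
    have h := norm_rectTubeTransferOperator_le (fundamentalRep (Fin 2)) (β / 2) (Ls := Ls)
      (continuous_fundamentalRep (Fin 2)) fundamentalRep_mem_unitaryGroup
    rwa [hc0', hJ] at h
  have hSge : Real.exp (-(β * P)) * (c0 ^ (N - Ls μ) * lam ^ (Ls μ)) ≤
      su2RectFluxMomentumPiNorm β Ls (Pi.single μ 1) ν := by
    have h := rectTubeFluxMomentumPiNorm_single_ge (fundamentalRep (Fin 2)) (β / 2) (Ls := Ls)
      (continuous_fundamentalRep (Fin 2)) fundamentalRep_mem_unitaryGroup two_ne_zero su2MinusOne_mem_center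
      fundamentalRep_su2MinusOne (su2_integral_exp_mul_apply (β / 2)) hμν hν
    rw [hc0', hlam', hJ] at h
    exact h
  have hTpos : 0 < ‖rectTubeTransferOperator (fundamentalRep (Fin 2)) (β / 2) Ls‖ :=
    norm_rectTubeTransferOperator_pos (β / 2) Ls (continuous_fundamentalRep (Fin 2))
  have hSpos : 0 < su2RectFluxMomentumPiNorm β Ls (Pi.single μ 1) ν :=
    lt_of_lt_of_le (mul_pos (Real.exp_pos _) (mul_pos (pow_pos hc0pos _) (pow_pos hlampos _))) hSge
  have h1' : Real.log ‖rectTubeTransferOperator (fundamentalRep (Fin 2)) (β / 2) Ls‖ ≤ β * P + (N : ℝ) * Real.log c0 := by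
    have h := Real.log_le_log hTpos hTle
    rwa [Real.log_mul (Real.exp_pos _).ne' (pow_pos hc0pos _).ne', Real.log_exp, Real.log_pow] at h
  have h2' : -(β * P) + (((N - Ls μ : ℕ) : ℝ) * Real.log c0 + ((Ls μ : ℕ) : ℝ) * Real.log lam) ≤
      Real.log (su2RectFluxMomentumPiNorm β Ls (Pi.single μ 1) ν) := by
    have h := Real.log_le_log (mul_pos (Real.exp_pos _) (mul_pos (pow_pos hc0pos _) (pow_pos hlampos _))) hSge
    rwa [Real.log_mul (Real.exp_pos _).ne' (mul_pos (pow_pos hc0pos _) (pow_pos hlampos _)).ne', Real.log_exp,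
      Real.log_mul (pow_pos hc0pos _).ne' (pow_pos hlampos _).ne', Real.log_pow, Real.log_pow] at h
  have hcast : (((N - Ls μ : ℕ) : ℝ)) = (N : ℝ) - ((Ls μ : ℕ) : ℝ) := by rw [Nat.cast_sub hLN]
  rw [hcast] at h2'
  have key : Real.log c0 - Real.log lam = -Real.log (su2CharacterRatio β) := by
    rw [← neg_sub, ← Real.log_div hlampos.ne' hc0pos.ne', hu]
  -- assemble
  unfold su2RectFluxMomentumPiEnergy rectTubeFluxMomentumPiEnergy
  change Real.log ‖rectTubeTransferOperator (fundamentalRep (Fin 2)) (β / 2) Ls‖ -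
      Real.log (su2RectFluxMomentumPiNorm β Ls (Pi.single μ 1) ν) ≤ _
  rw [← key]
  nlinarith [h1', h2']

end SU2

end Summit.Ventures.YMGap.FlowData
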